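import Summits.ResolutionOfSingularities.ResolutionOfSingularities.Theorems.MarkedTransferCampaignW46MohWindowShadeFormalInsepWalk
import Summits.ResolutionOfSingularities.ResolutionOfSingularities.Theorems.MarkedTransferCampaignW46MohWindowShadeFormalTerminates
import Summits.ResolutionOfSingularities.ResolutionOfSingularities.Theorems.MarkedTransferCampaignW46MohWindowShadeFormalFinite
import HarnessLib

/-!
# [OURS · L1 W4.6 rung (iii)] The FORMALLY PURELY INSEPARABLE surface window TERMINATES — rung (iii) of RESCUE-SEED W4.6 in the seed's
# purely-inseparable reading, `z^p = F(x, y)` with `F` ANY power series, CLOSED BY NAME over algebraically closed and over finite fields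

Cell `res-hironaka`, LADDER-RESOLUTION rung L (D-0089), slot W4.6 rung (iii) «purely inseparable `z^p = f(x, y)` with `ord f < 2p`»; seat
res-L1-s46-pv-6 (gen 6). Host route MarkedTransfer (`HypersurfaceOrderReduction`, stmt-ResolutionOfSingularities-16155), `--supports … --as
helper`; kind proof (closers of the TYPED-OURS statement file `…MohWindowShadeFormalInsepStatement.lean`, p543815).

WHAT IS PROVED (all OURS; o1's regime of record `regimeMohWindowSurfaceInsep` + «formally purely inseparable at every singular point»):
* `mohWindowSurfaceFormalInsepPermissiblyTerminates_of_isAlgClosed (p) (K) [IsAlgClosed K] : MohWindowSurfaceFormalInsepPermissiblyTerminates p K`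
  — THE CLOSER BY NAME: no infinite §2.1-permissible sequence (standard ideal exponents, permissible centres, blow-ups, controlled transforms) all of
  whose stages lie in `Regime.mohWindowSurfaceFormalInsep`; typed `Terminates ∧ TerminatesNabla` for every `N`, `Rd`.
* `…_of_finite [Finite K]` — the same over every FINITE field (residual rationality forced by the presentations at both ends of a thread step).
* `mohWindowSurfaceFormalInsep_rationalSing_permissiblyTerminates [PerfectField K]` — every PERFECT field, on `… ∩ Regime.rationalSing`.
* NON-VACUITY `exists_singular_state_mohWindowSurfaceFormalInsep` (gen 4's kernel witness through the nestings).
Assembly: res-L1-s46-pv-1's hit thread; the regime's anchor at the root, cleaned by a shear (brick 1); the SERIES shade-model walk along the thread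
(brick 3) and THE MODEL THEOREM OF THE POWER-SERIES PORT (`MohWindowShadePS.Series.exists_coordinate_or_digit_curve_of_walk`, this seat gen 6);
res-D-pv-050's exit door. This closes gap (A) of HOME/L/res-L1-s46-pv-6/GENERAL-REGIME-ANALYSIS.md: gen 5's two formal rungs (polynomial `F`;
power-series `F` with isolated surface singularity) are corollaries (`…_of_formalInsep`, statement file). NOT CLAIMED: the non-purely-inseparable
members of o1's regime (`f ∈ (x, y)^d·𝒪` involving `z`; s46-pv-14's (R3′)); non-rational singular points over infinite non-closed perfect fields;
anything about the manuscript. H. Hironaka, ms. 2017-03-23, Th. 16.6 p.84, Th. 16.13 p.87 — scope only, under adjudication [Hironaka2017].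
AI-written; AI review is weaker than expert review. References: H. Hauser, Bull. AMS 47 (2010) §§F–G; Stacks Project Tags 0804, 0CY7.
[Hauser2010] [StacksProject] [folklore]
-/

noncomputable section

set_option linter.dupNamespace false -- mandated namespace of this single-conjunct summit

open CategoryTheory AlgebraicGeometry TopologicalSpace IsLocalRing MvPolynomial

namespace Summit.ResolutionOfSingularities.ResolutionOfSingularities.Theorems

namespace CampaignW46

open CategoryTheory AlgebraicGeometry TopologicalSpace
open Literature.AlgebraicGeometry.Resolution
open Literature.AlgebraicGeometry.Resolution.Hauser2010
open Literature.AlgebraicGeometry.Hironaka2017.S02Preliminaries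
open Literature.AlgebraicGeometry.Hironaka2017.Datum
open Scheme.IdealSheafData

variable (p : ℕ) [hp : Fact p.Prime] (K : Type) [Field K] [CharP K p]

/-! ## §1 Perfect fields with rational singular points -/

/-- **No hit thread in the formally purely inseparable surface window regime with rational singular points** (any PERFECT `K`). [OURS · L1
W4.6 rung (iii)] NOT a statement of the manuscript: along a hit thread the points are singular, hence `K`-rational, hence residually rational over
their images (`germConst` is natural under the blow-ups); the root is formally purely inseparable by the regime. [cite: StacksProject, Tag 0804] -/
theorem mohWindowSurfaceFormalInsep_rationalSing_noHitThread [PerfectField K] :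
    NoHitThread (Regime.inter (Regime.mohWindowSurfaceFormalInsep (p := p) (K := K)) Regime.rationalSing) := by
  classical
  haveI : PerfectRing K p := PerfectField.toPerfectRing p
  intro r hr t
  refine MohWindowShadeFormalInsep.false_of_hitThread_formalInsepAt r (fun k => (hr k).1.1) t (fun k y => ?_)
    ((hr 0).1.2 (t.y 0) (t.mem 0))
  obtain ⟨l, hl⟩ := (hr (k + 1)).2 (t.y (k + 1)) (t.mem (k + 1)) y
  refine ⟨germConst (r.A k) ((r.π k).base (t.y (k + 1))) l, ?_⟩
  have hnat : ((r.π k).stalkMap (t.y (k + 1))).hom (germConst (r.A k) ((r.π k).base (t.y (k + 1))) l) =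
      germConst (r.A (k + 1)) (t.y (k + 1)) l :=
    MohWindowShadeAnchorWalk.stalkMap_germ_sectionConst (r.π k) (r.hom_eq k) (t.y (k + 1)) l
  rw [hnat]
  exact hl

/-- **RUNG (iii), FORMALLY PURELY INSEPARABLE WINDOW WITH RATIONAL SINGULAR POINTS, over EVERY PERFECT FIELD.** [OURS · L1 W4.6 rung (iii)]
NOT a statement of the manuscript. [cite: Hauser2010, §F (setting f = x^p + y^r g)] [cite: StacksProject, Tag 0804] -/
theorem mohWindowSurfaceFormalInsep_rationalSing_permissiblyTerminates [PerfectField K] :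
    PermissiblyTerminates (Regime.inter (Regime.mohWindowSurfaceFormalInsep (p := p) (K := K)) Regime.rationalSing) :=
  permissiblyTerminates_of_noHitThread (fun A E h => ((regimeMohWindowSurfaceInsep_iff A E).mp h.1.1).1.1)
    (mohWindowSurfaceFormalInsep_rationalSing_noHitThread p K)

/-! ## §2 Algebraically closed fields: THE CLOSER -/

/-- **No hit thread in the formally purely inseparable surface window regime** (algebraically closed `K`). [OURS · L1 W4.6 rung (iii)] NOT a
statement of the manuscript. [cite: StacksProject, Tag 0CY7] -/
theorem mohWindowSurfaceFormalInsep_noHitThread [IsAlgClosed K] : NoHitThread (Regime.mohWindowSurfaceFormalInsep (p := p) (K := K)) := by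
  classical
  intro r hr _
  exact MohWindowShadeFormalInsep.false_of_permissibleRun_insep_formalInsepStart r (fun k => (hr k).1) fun ξ hξ => (hr 0).2 ξ hξ

/-- **RUNG (iii), FORMALLY PURELY INSEPARABLE SURFACE WINDOW — CLOSED BY NAME over algebraically closed fields.** [OURS · L1 W4.6 rung (iii)]
NOT a statement of the manuscript: `MohWindowSurfaceFormalInsepPermissiblyTerminates p K` — no infinite §2.1-permissible sequence inside
`Regime.mohWindowSurfaceFormalInsep` (o1's purely inseparable surface window whose singular germs are `z^p + F(u₀, u₁)` in SOME Cohen coordinates,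
`F` ANY power series). [cite: Hauser2010, §F (setting f = x^p + y^r g)] [cite: StacksProject, Tag 0CY7] -/
theorem mohWindowSurfaceFormalInsepPermissiblyTerminates_of_isAlgClosed [IsAlgClosed K] : MohWindowSurfaceFormalInsepPermissiblyTerminates p K :=
  permissiblyTerminates_of_noHitThread (fun A E h => ((regimeMohWindowSurfaceInsep_iff A E).mp h.1).1.1)
    (mohWindowSurfaceFormalInsep_noHitThread p K)

/-- **The typed rungs**: over an algebraically closed field, for EVERY notion instance `N` and reading `Rd`, the typed Th. 16.6 procedure with the
literal centre rule (`Terminates`) and the ∇-centred one (`TerminatesNabla`) have no infinite run inside `Regime.mohWindowSurfaceFormalInsep`.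
[OURS · L1 W4.6 rung (iii)] NOT a statement of the manuscript. [folklore] -/
theorem terminates_mohWindowSurfaceFormalInsep_of_isAlgClosed [IsAlgClosed K] (n : ℕ) (N : Notions.{0} n) (Rd : Reading p K N) :
    Terminates N Rd (Regime.mohWindowSurfaceFormalInsep (p := p) (K := K)) ∧
      TerminatesNabla N Rd (Regime.mohWindowSurfaceFormalInsep (p := p) (K := K)) :=
  terminates_and_terminatesNabla_of_mohWindowSurfaceFormalInsepPermissiblyTerminates
    (mohWindowSurfaceFormalInsepPermissiblyTerminates_of_isAlgClosed p K) n N Rd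

/-! ## §3 Finite fields -/

/-- **No hit thread in the formally purely inseparable surface window regime over a FINITE field.** [OURS · L1 W4.6 rung (iii)] NOT a statement of
the manuscript: both ends of every thread step are presented `𝒪̂ ≃+* K⟦X⟧` by the regime, so their residue fields are `≃ K`, and an injection of
finite fields of equal cardinality is onto (res-L1-s46-pv-2's brick 16). [folklore] -/
theorem mohWindowSurfaceFormalInsep_noHitThread_of_finite [Finite K] :
    NoHitThread (Regime.mohWindowSurfaceFormalInsep (p := p) (K := K)) := by
  classical
  haveI : PerfectRing K p := PerfectField.toPerfectRing p
  intro r hr t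
  refine MohWindowShadeFormalInsep.false_of_hitThread_formalInsepAt r (fun k => (hr k).1) t (fun k y => ?_) ((hr 0).2 (t.y 0) (t.mem 0))
  -- presentations at both ends of the step `k → k+1`
  have hmem : (r.π k).base (t.y (k + 1)) ∈ (r.E k).sing := by rw [t.compat k]; exact t.mem k
  obtain ⟨hR, -, -, -, -⟩ := MohWindowShadeAnchorWalk.regime_point (hr k).1 hmem
  obtain ⟨hR', -, -, -, -⟩ := MohWindowShadeAnchorWalk.regime_point (hr (k + 1)).1 (t.mem (k + 1))
  haveI := hR
  haveI := hR'
  obtain ⟨e₀, -, -, -, -, -, -⟩ := (hr k).2 _ hmem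
  obtain ⟨e₁, -, -, -, -, -, -⟩ := (hr (k + 1)).2 _ (t.mem (k + 1))
  obtain ⟨eR⟩ := AtomGerm.nonempty_residueField_equiv_of_presentation e₀
  obtain ⟨eS⟩ := AtomGerm.nonempty_residueField_equiv_of_presentation e₁
  exact AtomGerm.exists_sub_map_mem_maximalIdeal_of_finite ((r.π k).stalkMap (t.y (k + 1))).hom eR eS y

/-- **RUNG (iii), FORMALLY PURELY INSEPARABLE SURFACE WINDOW — CLOSED BY NAME over every FINITE field.** [OURS · L1 W4.6 rung (iii)] NOT a
statement of the manuscript. [cite: Hauser2010, §F (setting f = x^p + y^r g)] -/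
theorem mohWindowSurfaceFormalInsepPermissiblyTerminates_of_finite [Finite K] : MohWindowSurfaceFormalInsepPermissiblyTerminates p K :=
  permissiblyTerminates_of_noHitThread (fun A E h => ((regimeMohWindowSurfaceInsep_iff A E).mp h.1).1.1)
    (mohWindowSurfaceFormalInsep_noHitThread_of_finite p K)

/-- **The typed rungs over a finite field.** [OURS · L1 W4.6 rung (iii)] NOT a statement of the manuscript. [folklore] -/
theorem terminates_mohWindowSurfaceFormalInsep_of_finite [Finite K] (n : ℕ) (N : Notions.{0} n) (Rd : Reading p K N) :
    Terminates N Rd (Regime.mohWindowSurfaceFormalInsep (p := p) (K := K)) ∧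
      TerminatesNabla N Rd (Regime.mohWindowSurfaceFormalInsep (p := p) (K := K)) :=
  terminates_and_terminatesNabla_of_mohWindowSurfaceFormalInsepPermissiblyTerminates
    (mohWindowSurfaceFormalInsepPermissiblyTerminates_of_finite p K) n N Rd

/-! ## §4 Non-vacuity -/

/-- **NON-VACUITY of the formally purely inseparable regime** (algebraically closed `K`): gen 4's kernel witness
`((z^p + x^(p+1) + y^(p+1))·𝒪, p)` on `𝔸³_K` (p522062) is a standard state of `Regime.mohWindowSurfaceFormalInsep` with non-empty singular locus —
the rung is not about the empty set. [OURS · L1 W4.6 rung (iii)] NOT a statement of the manuscript. [folklore] -/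
theorem exists_singular_state_mohWindowSurfaceFormalInsep [IsAlgClosed K] :
    ∃ (A : AmbientDatum p K) (E : IdealExponent A.Z),
      Regime.mohWindowSurfaceFormalInsep (p := p) (K := K) A E ∧ E.IsStandard ∧ E.sing.Nonempty := by
  obtain ⟨A, E, hRg, hst, hne⟩ := exists_singular_state_mohWindowSurfaceFormalPoly p K
  exact ⟨A, E, Regime.mohWindowSurfaceFormalPoly_le_formalInsep A E hRg, hst, hne⟩

end CampaignW46

end Summit.ResolutionOfSingularities.ResolutionOfSingularities.Theorems

end
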